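import Literature.AnabelianGeometry.SemiGraphs.BTempQDPairQuotientsRel
import Literature.AnabelianGeometry.SemiGraphs.TemperoidsGaloisObjectsProofs
import HarnessLib

/-!
# Semi-graphs of anabelioids, Appendix, proof of Theorem A.4: every connected object of `T` is the
# quotient `B/Γ_B` of a strongly connected QD-pair OF `Q = T[A]` (Galois domination)

Mochizuki, *Semi-graphs of anabelioids*, Publ. RIMS **42** (2006) 221–322, Appendix, proof of
Theorem A.4, manuscript p. 83 (PRIMS p. 313 ll. 2–5) [cite: MochizukiSemiAnbd2006, Thm A.4 proof p.83]:
"one verifies immediately that this functor `q_i` [`: D_i → T_i`, `(B, Γ_B) ↦ B/Γ_B`, with `D_i` the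
category of QD-pairs of `Q_i = T_i[A_i]`] is essentially surjective; … and that every connected
object of `T_i` is isomorphic to the image via `q_i` of a strongly connected QD-pair."

Row **A4-q′** of `plan/L3/SUBDAG-SemiAnbd-Cor311.md` (holder abc-iut-w5-d129).  The companion
`BTempQDPairQuotientFunctor.lean` proved these clauses for QD-pairs of the WHOLE temperoid
`T = B^temp(Π)`; print's `D_i` consists of QD-pairs of `Q_i = T_i[A_i]` only, i.e. `B` must admit an
arrow to `A`.  This file supplies the connected case in that CORRECT SCOPE, for the model temperoid
`B^temp(Π)` (`Π` tempered) and `T[A] = B^temp(Π)[Π/K] = BTempRel Π K` (`A = Π/K` connected,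
`K` open):

* `QDPair.GaloisDomination.translationGroup hG N H` — for `N ⊴ Π` open normal and `H` a subgroup,
  the subgroup of `Aut(Π/N)` of automorphisms moving the base point `N` into `H/N` (these are the
  right translations by elements of `H`, `GaloisObjects.exists_aut_quotientObj`);
* **`QDPair.GaloisDomination.isQuotient_orbitMap`**: if `N ≤ Stab(x₀)`, the orbit map
  `Π/N → X`, `N ↦ x₀`, FORMS A QUOTIENT (Def. A.3 (iii)) of the strongly connected QD-pair
  `(Π/N, translationGroup N Stab(x₀))` whenever `X` is connected (criterion
  `QDPair.isQuotient_iff_surjective`: invariance because `Stab(x₀)` fixes `x₀`, surjectivity because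
  `X` is one orbit, fibres because `g x₀ = g′ x₀ ⇒ g⁻¹g′ ∈ Stab(x₀)` is a translation);
* **`QDPair.exists_stronglyConnected_rel_orbitQuotient_iso`**: for `X` connected and `A = Π/K`
  (`K` open) there is a STRONGLY CONNECTED QD-pair `(B, Γ)` of `B^temp(Π)` with `B` ADMITTING AN
  ARROW TO `Π/K` (so `(B, Γ)` is a QD-pair of `T[A]`) and `B/Γ ≅ X` — `B := Π/N` for an open normal
  `N ≤ Stab(x₀) ∩ K`, which exists because `Π` is tempered (`IsTempered.basis`).

Elementary; nothing refers to the IUT corpus; no side is taken on any disputed claim.  (The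
extension to non-connected `X` — countable coproducts of such pairs — is the remaining part of row
A4-q′.)
-/

open CategoryTheory Topology

namespace Literature.AnabelianGeometry.SemiGraphs

open Literature.AlgebraicGeometry.Frobenioids (IsConnectedObj)
open Literature.AlgebraicGeometry.Frobenioids.QuasiTemperoid (BTempRel cosetAction admitsHomToCoset)
open Literature.AlgebraicGeometry.Frobenioids.QuasiTemperoid.BTempConnected (hom_ρ hom_ext_apply
  ρ_one_apply ρ_mul_apply ρ_inv_apply nonempty_of_isConnectedObj exists_ρ_eq_of_isConnectedObj
  hom_eq_of_apply_eq)
open GaloisObjects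

universe u

namespace QDPair

namespace GaloisDomination

variable {G : Type u} [Group G] [TopologicalSpace G] [IsTopologicalGroup G] (hG : IsTempered G)
  (N : Subgroup G) [N.Normal] (hN : IsOpen (N : Set G)) (H : Subgroup G)

/-- The automorphisms of `Π/N` moving the base point `N` to `hN` with `h ∈ H` (for `N ⊴ Π` open
normal: the right translations by `H`). [cite: MochizukiSemiAnbd2006, Thm A.4 proof p.83] -/
def translationGroup : Subgroup (Aut (BTemp.quotientObj G hG N hN)) where
  carrier := {τ | ∃ h ∈ H, (τ.hom.hom.hom ((1 : G) : G ⧸ N) : G ⧸ N) = (h : G ⧸ N)}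
  one_mem' := ⟨1, H.one_mem, rfl⟩
  mul_mem' := by
    rintro σ τ ⟨h, hh, hσ⟩ ⟨k, hk, hτ⟩
    refine ⟨k * h, H.mul_mem hk hh, ?_⟩
    change (σ.hom.hom.hom (τ.hom.hom.hom ((1 : G) : G ⧸ N)) : G ⧸ N) = ((k * h : G) : G ⧸ N)
    rw [hτ, ← quotientObj_ρ_one hG N hN k, hom_ρ, hσ, quotientObj_ρ_mk]
  inv_mem' := by
    rintro σ ⟨h, hh, hσ⟩
    refine ⟨h⁻¹, H.inv_mem hh, ?_⟩
    change (σ.inv.hom.hom ((1 : G) : G ⧸ N) : G ⧸ N) = ((h⁻¹ : G) : G ⧸ N)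
    have h1 : (σ.inv.hom.hom (σ.hom.hom.hom ((1 : G) : G ⧸ N)) : G ⧸ N) = ((1 : G) : G ⧸ N) := by
      change ((σ.hom ≫ σ.inv).hom.hom ((1 : G) : G ⧸ N) : G ⧸ N) = _
      rw [σ.hom_inv_id]; rfl
    rw [hσ, ← quotientObj_ρ_one hG N hN h, hom_ρ] at h1
    -- `h1 : h · σ⁻¹(N) = N`
    have h2 := congrArg ((BTemp.quotientObj G hG N hN).obj.ρ h⁻¹) h1
    rw [ρ_inv_apply, quotientObj_ρ_one] at h2
    exact h2

omit [N.Normal] in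
/-- Membership in the translation group. [cite: MochizukiSemiAnbd2006, Thm A.4 proof p.83] -/
theorem mem_translationGroup_iff (τ : Aut (BTemp.quotientObj G hG N hN)) :
    τ ∈ translationGroup hG N hN H ↔
      ∃ h ∈ H, (τ.hom.hom.hom ((1 : G) : G ⧸ N) : G ⧸ N) = (h : G ⧸ N) :=
  Iff.rfl

/-- The QD-pair `(Π/N, translations by H)`. [cite: MochizukiSemiAnbd2006, Thm A.4 proof p.83] -/
def pair : QDPair (BTemp G) := ⟨BTemp.quotientObj G hG N hN, translationGroup hG N hN H⟩

omit [N.Normal] in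
/-- It is strongly connected (`Π/N` is one orbit). [cite: MochizukiSemiAnbd2006, Thm A.4 proof p.83] -/
theorem pair_isStronglyConnected : (pair hG N hN H).IsStronglyConnected :=
  isConnectedObj_quotientObj hG N hN

variable {N H}

/-- **The orbit map `Π/N → X`, `N ↦ x₀`, forms a quotient of `(Π/N, translations by Stab(x₀))`**
when `N ≤ Stab(x₀)` and `X` is connected: it is invariant (a translation by `h ∈ Stab(x₀)` followed
by the orbit map is again `N ↦ x₀`), surjective (`X` is one orbit) and its fibres are translation
orbits (`g x₀ = g′ x₀ ⇒ g⁻¹ g′ ∈ Stab(x₀)`). [cite: MochizukiSemiAnbd2006, Thm A.4 proof p.83] -/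
theorem isQuotient_orbitMap {X : BTemp G} (hX : IsConnectedObj X) (x₀ : X.obj.V)
    (hH : ∀ k : G, k ∈ H ↔ X.obj.ρ k x₀ = x₀)
    (φ : BTemp.quotientObj G hG N hN ⟶ X) (hφ : (φ.hom.hom ((1 : G) : G ⧸ N) : X.obj.V) = x₀) :
    (pair hG N hN H).IsQuotient φ := by
  have hφg : ∀ g : G, (φ.hom.hom (g : G ⧸ N) : X.obj.V) = X.obj.ρ g x₀ := fun g => by
    rw [← quotientObj_ρ_one hG N hN g, hom_ρ, hφ]
  refine ((pair hG N hN H).isQuotient_iff_surjective φ).mpr ⟨?_, ?_, ?_⟩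
  · -- invariance
    rintro τ ⟨h, hh, hτ⟩
    refine hom_eq_of_apply_eq (isConnectedObj_quotientObj hG N hN) _ _ ((1 : G) : G ⧸ N) ?_
    change (φ.hom.hom (τ.hom.hom.hom ((1 : G) : G ⧸ N)) : X.obj.V) = φ.hom.hom ((1 : G) : G ⧸ N)
    have h1 : (φ.hom.hom (τ.hom.hom.hom ((1 : G) : G ⧸ N)) : X.obj.V) = φ.hom.hom ((h : G) : G ⧸ N) :=
      congrArg (fun z => (φ.hom.hom z : X.obj.V)) hτ
    rw [h1, hφg, hφ]
    exact (hH h).mp hh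
  · -- surjective
    intro x
    obtain ⟨g, hg⟩ := exists_ρ_eq_of_isConnectedObj X hX x₀ x
    exact ⟨(g : G ⧸ N), (hφg g).trans hg⟩
  · -- fibres are translation orbits
    intro q q' hqq'
    obtain ⟨g, rfl⟩ := QuotientGroup.mk_surjective q
    obtain ⟨g', rfl⟩ := QuotientGroup.mk_surjective q'
    change (φ.hom.hom (g : G ⧸ N) : X.obj.V) = φ.hom.hom (g' : G ⧸ N) at hqq'
    rw [hφg, hφg] at hqq'
    -- `h := g⁻¹ g' ∈ Stab(x₀)`
    have hh : g⁻¹ * g' ∈ H := by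
      rw [hH, ρ_mul_apply, ← hqq', ρ_inv_apply]
    obtain ⟨τ, hτ⟩ := exists_aut_quotientObj hG N hN (g⁻¹ * g')
    refine ⟨τ, ⟨g⁻¹ * g', hh, hτ⟩, ?_⟩
    change (τ.hom.hom.hom (g : G ⧸ N) : G ⧸ N) = (g' : G ⧸ N)
    rw [← quotientObj_ρ_one hG N hN g, hom_ρ, hτ, quotientObj_ρ_mk, mul_inv_cancel_left]

end GaloisDomination

/-- **"Every connected object of `T_i` is isomorphic to the image via `q_i` of a strongly connected
QD-pair" OF `Q_i = T_i[A_i]`**, for `T = B^temp(Π)`, `Π` tempered, `A = Π/K` (`K` open): for `X`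
connected there are an open normal `N ≤ Π` and a subgroup `Γ ≤ Aut(Π/N)` such that `Π/N` ADMITS AN
ARROW TO `Π/K` (so `(Π/N, Γ)` is a QD-pair of `T[A] = B^temp(Π)[Π/K]`), `(Π/N, Γ)` is strongly
connected, and `(Π/N)/Γ ≅ X`. [cite: MochizukiSemiAnbd2006, Thm A.4 proof p.83] -/
theorem exists_stronglyConnected_rel_orbitQuotient_iso {G : Type u} [Group G] [TopologicalSpace G]
    [IsTopologicalGroup G] (hG : IsTempered G) {K : Subgroup G} (hK : IsOpen (K : Set G))
    (X : BTemp G) (hX : IsConnectedObj X) :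
    ∃ P : QDPair (BTemp G), admitsHomToCoset G K P.A ∧ P.IsStronglyConnected ∧
      Nonempty (P.orbitQuotient ≅ X) := by
  classical
  obtain ⟨x₀⟩ := nonempty_of_isConnectedObj X hX
  letI : MulAction G X.obj.V := Action.instMulAction X.obj
  -- the stabiliser of `x₀`, an open subgroup
  let H : Subgroup G := MulAction.stabilizer G x₀
  have hHmem : ∀ k : G, k ∈ H ↔ X.obj.ρ k x₀ = x₀ := fun k => MulAction.mem_stabilizer_iff
  have hHopen : IsOpen (H : Set G) := X.property.2 x₀
  -- an open normal subgroup inside `Stab(x₀) ∩ K` (Π tempered)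
  have hU : ((H ⊓ K : Subgroup G) : Set G) ∈ 𝓝 (1 : G) :=
    (hHopen.inter hK).mem_nhds ⟨H.one_mem, K.one_mem⟩
  obtain ⟨N, -, hNU⟩ := hG.basis _ hU
  haveI : N.toSubgroup.Normal := N.isNormal'
  have hNH : ∀ k : G, k ∈ N.toSubgroup → k ∈ H := fun k hk => (hNU hk).1
  have hNK : ∀ k : G, k ∈ N.toSubgroup → k ∈ K := fun k hk => (hNU hk).2
  -- the orbit map `Π/N → X` and the arrow `Π/N → Π/K`
  obtain ⟨φ, hφ⟩ := exists_hom_quotientObj hG N.toSubgroup N.isOpen' (X := X) x₀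
    (fun k hk => (hHmem k).mp (hNH k hk))
  obtain ⟨β, -⟩ := exists_hom_quotientObj hG N.toSubgroup N.isOpen'
    (X := Literature.AlgebraicGeometry.Frobenioids.QuasiTemperoid.cosetObj G hG K hK)
    ((1 : G) : G ⧸ K) (fun k hk => by
      change k • ((1 : G) : G ⧸ K) = ((1 : G) : G ⧸ K)
      rw [MulAction.Quotient.smul_mk, smul_eq_mul, mul_one, QuotientGroup.eq, mul_one]
      exact K.inv_mem (hNK k hk))
  refine ⟨GaloisDomination.pair hG N.toSubgroup N.isOpen' H, ⟨β.hom⟩,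
    GaloisDomination.pair_isStronglyConnected hG N.toSubgroup N.isOpen' H, ?_⟩
  obtain ⟨e, -, -⟩ := (GaloisDomination.isQuotient_orbitMap hG N.isOpen' hX x₀ hHmem φ
    hφ).existsUnique_iso_orbitQuotient
  exact ⟨e⟩

/-- The same packaged as a QD-pair of `T[A] = BTempRel Π K` whose underlying QD-pair of
`B^temp(Π)` (`QDPair.toBTemp`) has orbit space `≅ X`. [cite: MochizukiSemiAnbd2006, Thm A.4 proof p.83] -/
theorem exists_stronglyConnected_bTempRel_orbitQuotient_iso {G : Type u} [Group G]
    [TopologicalSpace G] [IsTopologicalGroup G] (hG : IsTempered G) {K : Subgroup G}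
    (hK : IsOpen (K : Set G)) (X : BTemp G) (hX : IsConnectedObj X) :
    ∃ P : QDPair (BTempRel G K), IsConnectedObj P.A.obj ∧ Nonempty (P.toBTemp.orbitQuotient ≅ X) := by
  obtain ⟨P, hPA, hPc, ⟨e⟩⟩ := exists_stronglyConnected_rel_orbitQuotient_iso hG hK X hX
  -- lift `Γ` along the fully faithful inclusion `T[A] ⥤ T`
  let A' : BTempRel G K := ⟨P.A, hPA⟩
  let ι : Aut A' →* Aut P.A := Functor.mapAut A' (admitsHomToCoset G K).ι
  refine ⟨⟨A', P.Γ.comap ι⟩, hPc, ?_⟩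
  -- `(Γ.comap ι).map ι = Γ` since `ι` is surjective (full subcategory)
  have hsurj : Function.Surjective ι := fun γ =>
    ⟨(admitsHomToCoset G K).fullyFaithfulι.preimageIso γ, by
      ext; rfl⟩
  have hΓ : (P.Γ.comap ι).map ι = P.Γ := Subgroup.map_comap_eq_self_of_surjective hsurj _
  have hto : (⟨A', P.Γ.comap ι⟩ : QDPair (BTempRel G K)).toBTemp = P := by
    change (⟨P.A, (P.Γ.comap ι).map ι⟩ : QDPair (BTemp G)) = P
    rw [hΓ]
  rw [hto]
  exact ⟨e⟩

end QDPair

end Literature.AnabelianGeometry.SemiGraphs
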